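import Mathlib
import HarnessLib
import Literature.MathematicalPhysics.KineticTheory.HardSphereEulerProofs
import Summits.AtomisticToContinuum.HydrodynamicLimit.Theses.OneFlightGossipEngine
import Summits.AtomisticToContinuum.HydrodynamicLimit.Theorems.OneFlightGossipEngineKineticCurrentsLDAlongFamiliesKCWUSharpPlus

/-!
# The kinetic window LD along families with a tilt threshold EXPLICIT in the growth constant
# (stub S_E `stub_explicitKineticFamily` of line `tail-rate`, crux stmt-AtomisticToContinuum-16625
# `TwoClocks.TransferEntropyClock`)

Crux `TwoClocks.TransferEntropyClock` (stmt-AtomisticToContinuum-16625), line `tail-rate`, skeleton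
`Cruxes/TransferEntropyClock/Lines/tail_rate.lean`. The three statements `KCWUSharpPlus`,
`KineticLDExplicitFamily`, `ExplicitKineticFamilyUpgrade` of its §1 are re-declared here VERBATIM (§1), and
the registered stub

* **`stub_explicitKineticFamily : ExplicitKineticFamilyUpgrade`** (`:= KCWUSharpPlus → KineticLDExplicitFamily`)

is proved (§4). In words: the POINTWISE kinetic-window LD rung with a NUMERIC tilt threshold
`β₀(Θ,U,C,Λ,σ)` for the class `A(x):w⊗w + (b(x)·w)G(x,|w|²) + K(x,|w|²)` (the open stub of crux 16659,
taken as the hypothesis) implies the kinetic window LD ALONG FAMILIES `s ↦ (a_s, θ_s, u_s)` for the class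
`A_s(x):w⊗w + (b_s(x)·w)G_s(x,|w|²)` with a threshold `β₁` chosen after the profile family, `σ` and the
flows and BEFORE the weights `(A, b, G)` and their quadratic-growth constant `C`, the bound holding for all
`|β| ≤ β₁ / C`.

Proof. §2 `transferByNets_explicit` re-runs the landed net transfer S7′ of crux 16659
(`KineticCurrentsLDAlongFamiliesSketch.stub_transferByNetsEv`, p137211; composed in p137412) from
`KCWUSharpPlus` with ONE change of bookkeeping: the growth constant `C` is quantified BEFORE the weights,
and the numeric profile bounds `(Θ, U, Λ)` are taken from the family-modulus statics S6
(`stub_familyModulus`) at the ZERO weights, so that the threshold `min(β₁(Θ,U,C,Λ,σ)/4, γ₀/(24(C+1)))` —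
`β₁` from the rung's instance `K = 0` (`kcwuSharp_of_kcwuSharpPlus`), `γ₀` from the weight-independent
family window tails (S9 `stub_windowTailsFamily_of_pointwise` over S10 `stub_radialTailsAt` fed by the
instance `A = b = G = 0` `kcwuSharpRadial_of_kcwuSharpPlus`, S8 `stub_radialTailDominator`, S5
`stub_lawChangeFamily`) — is visibly independent of `(A, b, G)`; every measure-theoretic step is a landed
helper (`tbn_*`). §3 `kineticLDExplicitFamily_of_kcwuSharpPlus` is the scaling `F ↦ F/C`: the class is a
cone (`A/C`, `b/C`, same `G`), orthogonality to `1, v_j, ‖v‖²` is linear, `|F/C| ≤ 1·(1+‖v‖²)`, and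
`exp(β Σᵢ w⁻¹∫₀ʷ F) = exp((βC) Σᵢ w⁻¹∫₀ʷ (F/C))` with `|βC| ≤ β₁` iff `|β| ≤ β₁/C`; so §2 at `C = 1`
gives the node (§4).

References: S. Olla, S. R. S. Varadhan, H.-T. Yau, Comm. Math. Phys. 155 (1993) §2; H. Spohn,
*Large Scale Dynamics of Interacting Particles* (1991), Part I §2.3.
-/

noncomputable section

open MeasureTheory Set Filter
open scoped ENNReal Topology

namespace Summit.AtomisticToContinuum.HydrodynamicLimit.Theorems.TransferEntropyClockExplicitKineticFamily

open Literature.Analysis.FluidPDE (HardSphereFlow Config localMaxwellian canonicalDensity liouville)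
open Literature.MathematicalPhysics.KineticTheory (T3 V3 hsDiameter localGibbsLaw localGibbsMeasure
  localGibbsProfile)
open Literature.Analysis.FluidPDE Literature.MathematicalPhysics.KineticTheory
open Summit.AtomisticToContinuum.HydrodynamicLimit.Theorems.KineticCurrentsLDAlongFamiliesSketch

/-! ## §1 Statements (verbatim from the skeleton `Cruxes/TransferEntropyClock/Lines/tail_rate.lean` §1) -/

/-- **S_K target `KCWUSharpPlus`** — byte-identical with the registered open stub `stub_kcwuSharpPlus` of crux
stmt-AtomisticToContinuum-16659 (line `Sketch` v6): the POINTWISE kinetic-window LD rung with a NUMERIC tilt threshold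
`β₀ = β₀(Θ,U,C,Λ,σ)` for the class `A(x):w⊗w + (b(x)·w)G(x,|w|²) + K(x,|w|²)`, `w = v − u₀(x)`, growth `C(1+‖v‖²)`,
orthogonal to `1, v_j, ‖v‖²` under the local Maxwellian at every `x`. -/
def KCWUSharpPlus : Prop :=
  ∃ η₀ : ℝ, 0 < η₀ ∧ ∀ (Θ U C Λ : ℝ), 1 ≤ Θ → 0 ≤ U → 0 ≤ C → 1 ≤ Λ → ∀ σ : ℝ, 0 < σ →
      ∃ β₀ : ℝ, 0 < β₀ ∧
      ∀ (a θ₀ : T3 → ℝ) (u₀ : T3 → V3), Continuous a → Continuous θ₀ → Continuous u₀ →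
      (∀ x, Λ⁻¹ ≤ a x ∧ a x ≤ Λ) → (∀ x, Θ⁻¹ ≤ θ₀ x ∧ θ₀ x ≤ Θ) → (∀ x, ‖u₀ x‖ ≤ U) →
      σ ^ 3 * (⨆ x, a x) ≤ η₀ * ∫ x, a x →
      ∀ Φ : (N : ℕ) →
        HardSphereFlow (Torus.geometry (Fin 3)) (hsDiameter σ N) (N + 1),
      ∀ (A : T3 → Fin 3 → Fin 3 → ℝ) (b : T3 → V3) (G K : T3 × ℝ → ℝ),
      Continuous A → Continuous b → Continuous G → Continuous K →
      ∀ F : T3 × V3 → ℝ, (∀ y, F y =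
        (∑ j : Fin 3, ∑ k : Fin 3, A y.1 j k * ((y.2 - u₀ y.1) j * (y.2 - u₀ y.1) k)) +
          (∑ j : Fin 3, b y.1 j * (y.2 - u₀ y.1) j) * G (y.1, ‖y.2 - u₀ y.1‖ ^ 2) +
          K (y.1, ‖y.2 - u₀ y.1‖ ^ 2)) →
      (∀ y, |F y| ≤ C * (1 + ‖y.2‖ ^ 2)) →
      (∀ x, ∫ v, F (x, v) * localMaxwellian 1 (θ₀ x) (u₀ x) v = 0) →
      (∀ x (j : Fin 3), ∫ v, F (x, v) * v j * localMaxwellian 1 (θ₀ x) (u₀ x) v = 0) →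
      (∀ x, ∫ v, F (x, v) * ‖v‖ ^ 2 * localMaxwellian 1 (θ₀ x) (u₀ x) v = 0) →
      ∀ β : ℝ, |β| ≤ β₀ → ∀ ε : ℝ, 0 < ε → ∃ τ₀ : ℝ, 0 < τ₀ ∧ ∀ τ : ℝ, τ₀ ≤ τ →
      ∃ N₀ : ℕ, ∀ N : ℕ, N₀ ≤ N →
        ∫⁻ z, ENNReal.ofReal (Real.exp (β * ∑ i : Fin (N + 1),
            (τ * ((N : ℝ) + 1) ^ (-(1 / 3 : ℝ)))⁻¹ *
              ∫ r in (0 : ℝ)..(τ * ((N : ℝ) + 1) ^ (-(1 / 3 : ℝ))), F (((Φ N).flow r z) i)))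
          ∂(localGibbsLaw σ a u₀ θ₀ N (Φ N)) ≤
        ENNReal.ofReal (Real.exp (ε * ((N : ℝ) + 1)))

/-- **S_E target `KineticLDExplicitFamily`** — the kinetic window LD ALONG FAMILIES with a threshold EXPLICIT IN THE GROWTH
CONSTANT: frame of the heart's `KineticCurrentsWindowLDFamily` (= crux 16659, same body), but `∃ β₁ > 0` is chosen after the
profile family `s ↦ (a_s, θ_s, u_s)`, `σ` and the flows and BEFORE the weights `(A, b, G)` and their quadratic-growth constant
`C`, and the bound is asserted for `|β| ≤ β₁ / C`. So along a truncation family `G_m` with constants `C₀ m` the threshold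
degrades exactly like `1/m` — the law forced by large Galilean boosts (see the module docstring) and all this line needs.
Strictly between the consumable-but-unprovable-from-black-boxes `∃ β₀`-per-instance node and the refuted `∀ β` node
(`TransferEntropyClockNegative.not_kineticWindowLDBoundedAllBeta`, p127781). Implies 16659 (take the family's own `C`). -/
def KineticLDExplicitFamily : Prop :=
  ∃ η₀ : ℝ, 0 < η₀ ∧ ∀ (t₁ : ℝ) (a θ₀ : ℝ → T3 → ℝ) (u₀ : ℝ → T3 → V3),
    Continuous (Function.uncurry a) → Continuous (Function.uncurry θ₀) → Continuous (Function.uncurry u₀) →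
    (∀ s x, 0 < a s x) → (∀ s x, 0 < θ₀ s x) →
    ∀ σ : ℝ, 0 < σ → (∀ s ∈ Set.Icc 0 t₁, σ ^ 3 * (⨆ x, a s x) ≤ η₀ * ∫ x, a s x) →
    ∀ Φ : (N : ℕ) → HardSphereFlow (Torus.geometry (Fin 3)) (hsDiameter σ N) (N + 1),
    ∃ β₁ : ℝ, 0 < β₁ ∧
    ∀ (A : ℝ → T3 → Fin 3 → Fin 3 → ℝ) (b : ℝ → T3 → V3) (G : ℝ → T3 × ℝ → ℝ),
    Continuous (Function.uncurry A) → Continuous (Function.uncurry b) → Continuous (Function.uncurry G) →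
    ∀ C : ℝ, 0 < C →
    (let F := fun (s : ℝ) (y : T3 × V3) =>
       (∑ j : Fin 3, ∑ k : Fin 3, A s y.1 j k * ((y.2 - u₀ s y.1) j * (y.2 - u₀ s y.1) k)) +
         (∑ j : Fin 3, b s y.1 j * (y.2 - u₀ s y.1) j) * G s (y.1, ‖y.2 - u₀ s y.1‖ ^ 2)
     (∀ s ∈ Set.Icc 0 t₁, ∀ y : T3 × V3, |F s y| ≤ C * (1 + ‖y.2‖ ^ 2)) →
     (∀ s ∈ Set.Icc 0 t₁, ∀ x, ∫ v, F s (x, v) * localMaxwellian 1 (θ₀ s x) (u₀ s x) v = 0) →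
     (∀ s ∈ Set.Icc 0 t₁, ∀ x (j : Fin 3),
        ∫ v, F s (x, v) * v j * localMaxwellian 1 (θ₀ s x) (u₀ s x) v = 0) →
     (∀ s ∈ Set.Icc 0 t₁, ∀ x, ∫ v, F s (x, v) * ‖v‖ ^ 2 * localMaxwellian 1 (θ₀ s x) (u₀ s x) v = 0) →
     ∀ β : ℝ, |β| ≤ β₁ / C → ∀ ε : ℝ, 0 < ε → ∃ τ₀ : ℝ, 0 < τ₀ ∧ ∀ τ : ℝ, τ₀ ≤ τ →
     ∃ N₀ : ℕ, ∀ N : ℕ, N₀ ≤ N → ∀ s ∈ Set.Icc 0 t₁,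
       ∫⁻ z, ENNReal.ofReal (Real.exp (β * ∑ i : Fin (N + 1),
           (τ * ((N : ℝ) + 1) ^ (-(1 / 3 : ℝ)))⁻¹ *
             ∫ r in (0 : ℝ)..(τ * ((N : ℝ) + 1) ^ (-(1 / 3 : ℝ))), F s ((Φ N).flow r z i)))
         ∂(localGibbsLaw σ (a s) (u₀ s) (θ₀ s) N (Φ N)) ≤
       ENNReal.ofReal (Real.exp (ε * ((N : ℝ) + 1))))

/-- S_E as an implication: the explicit family node from the numeric pointwise rung. -/
def ExplicitKineticFamilyUpgrade : Prop :=
  KCWUSharpPlus → KineticLDExplicitFamily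

/-! ## §2 The net transfer with the growth constant quantified before the weights -/

/-- **The net transfer with a weight-independent threshold** (the landed S7′
`KineticCurrentsLDAlongFamiliesSketch.stub_transferByNetsEv` of crux 16659, re-run from `KCWUSharpPlus`
with the growth constant `C ≥ 0` quantified BEFORE the weights): the pointwise rung with numeric tilt
threshold (instance `K = 0` of the hypothesis), the landed family window tails eventually in `τ` (S9 over
S10, S8, S5, S6, fed by the instance `A = b = G = 0` of the hypothesis), the landed static change of
reference law (S5) and family bounds/modulus (S6) give, for every profile family, `σ`, flows and `C`, ONE
threshold `β₁ := min(β₁^{rung}(Θ,U,C,Λ,σ)/4, γ₀/(24(C+1)))` — `(Θ,U,Λ)` from S6 at the ZERO weights, `γ₀`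
from the tails — serving every weight family `(A, b, G)` of growth `C(1+‖v‖²)` on `[0,t₁]`: for `|β| ≤ β₁`
the window LD bound holds uniformly in `s ∈ [0,t₁]`. Same finite net in `s` as S7′ (nodes
`s_k = min(t₁,kδ)`, the rung at the nodes with tilt `4β`, change of law `λ_{s'} → λ_{s_k}`, pathwise
bound `ω(N+1) + 6C·(window tails)` of `F_{s'} − F_{s_k}`, helpers `tbn_*`). [folklore] -/
theorem transferByNets_explicit (hK : KCWUSharpPlus) :
    ∃ η₀ : ℝ, 0 < η₀ ∧ ∀ (t₁ : ℝ) (a θ₀ : ℝ → T3 → ℝ) (u₀ : ℝ → T3 → V3),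
      Continuous (Function.uncurry a) → Continuous (Function.uncurry θ₀) →
      Continuous (Function.uncurry u₀) → (∀ s x, 0 < a s x) → (∀ s x, 0 < θ₀ s x) →
      ∀ σ : ℝ, 0 < σ → (∀ s ∈ Icc 0 t₁, σ ^ 3 * (⨆ x, a s x) ≤ η₀ * ∫ x, a s x) →
      ∀ Φ : (N : ℕ) → HardSphereFlow (Torus.geometry (Fin 3)) (hsDiameter σ N) (N + 1),
      ∀ C : ℝ, 0 ≤ C →
      ∃ β₁ : ℝ, 0 < β₁ ∧
      ∀ (A : ℝ → T3 → Fin 3 → Fin 3 → ℝ) (b : ℝ → T3 → V3) (G : ℝ → T3 × ℝ → ℝ),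
      Continuous (Function.uncurry A) → Continuous (Function.uncurry b) →
      Continuous (Function.uncurry G) →
      ∀ F : ℝ → T3 × V3 → ℝ, (∀ s y, F s y =
        (∑ j : Fin 3, ∑ k : Fin 3, A s y.1 j k * ((y.2 - u₀ s y.1) j * (y.2 - u₀ s y.1) k)) +
          (∑ j : Fin 3, b s y.1 j * (y.2 - u₀ s y.1) j) * G s (y.1, ‖y.2 - u₀ s y.1‖ ^ 2)) →
      (∀ s ∈ Icc 0 t₁, ∀ y : T3 × V3, |F s y| ≤ C * (1 + ‖y.2‖ ^ 2)) →
      (∀ s ∈ Icc 0 t₁, ∀ x, ∫ v, F s (x, v) * localMaxwellian 1 (θ₀ s x) (u₀ s x) v = 0) →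
      (∀ s ∈ Icc 0 t₁, ∀ x (j : Fin 3),
        ∫ v, F s (x, v) * v j * localMaxwellian 1 (θ₀ s x) (u₀ s x) v = 0) →
      (∀ s ∈ Icc 0 t₁, ∀ x,
        ∫ v, F s (x, v) * ‖v‖ ^ 2 * localMaxwellian 1 (θ₀ s x) (u₀ s x) v = 0) →
      ∀ β : ℝ, |β| ≤ β₁ → ∀ ε : ℝ, 0 < ε → ∃ τ₀ : ℝ, 0 < τ₀ ∧ ∀ τ : ℝ, τ₀ ≤ τ →
      ∃ N₀ : ℕ, ∀ N : ℕ, N₀ ≤ N → ∀ s ∈ Icc 0 t₁,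
        ∫⁻ z, ENNReal.ofReal (Real.exp (β * ∑ i : Fin (N + 1),
            (τ * ((N : ℝ) + 1) ^ (-(1 / 3 : ℝ)))⁻¹ *
              ∫ r in (0 : ℝ)..(τ * ((N : ℝ) + 1) ^ (-(1 / 3 : ℝ))), F s ((Φ N).flow r z i)))
          ∂(localGibbsLaw σ (a s) (u₀ s) (θ₀ s) N (Φ N)) ≤
        ENNReal.ofReal (Real.exp (ε * ((N : ℝ) + 1))) := by
  -- adapted from `KineticCurrentsLDAlongFamiliesSketch.stub_transferByNetsEv` (Theorems/
  -- OneFlightGossipEngineKineticCurrentsLDAlongFamiliesTransferByNetsEv.lean): same net, the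
  -- profile bounds taken at the zero weights and `C` introduced before `β₁`
  obtain ⟨η₁, hη₁, hK'⟩ := kcwuSharp_of_kcwuSharpPlus hK
  obtain ⟨ηT, hηT, hT'⟩ := stub_windowTailsFamily_of_pointwise
    (stub_radialTailsAt (kcwuSharpRadial_of_kcwuSharpPlus hK) stub_radialTailDominator)
    stub_lawChangeFamily stub_familyModulus
  refine ⟨min η₁ (min ηT (1 / 8)), lt_min hη₁ (lt_min hηT (by norm_num)), ?_⟩
  intro t₁ a θ₀ u₀ ha hθ hu ha0 hθ0 σ hσ hguard Φ C hC0
  -- the degenerate parameter interval `t₁ < 0`: everything is vacuous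
  by_cases ht : t₁ < 0
  · refine ⟨1, one_pos, fun A b G _ _ _ F _ _ _ _ _ β _ ε _ => ⟨1, one_pos, fun τ _ => ⟨0, ?_⟩⟩⟩
    exact fun N _ s hs => absurd (hs.1.trans hs.2) (not_le.2 ht)
  replace ht : 0 ≤ t₁ := not_lt.1 ht
  have h0 : (0 : ℝ) ∈ Icc 0 t₁ := ⟨le_rfl, ht⟩
  -- Step 1: the guard gives `σ ≤ 1/2` (at `s = 0`), the S1-guard and the tails' guard at every `s`
  have hint_le : ∀ s, ∫ x, a s x ≤ ⨆ x, a s x := fun s =>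
    KineticCurrentsWindowLDUniformSketch.integral_le_iSup_T3 (ha.uncurry_left s)
  have hint_nn : ∀ s, 0 ≤ ∫ x, a s x := fun s => integral_nonneg fun x => (ha0 s x).le
  have hguard1 : ∀ s ∈ Icc 0 t₁, σ ^ 3 * (⨆ x, a s x) ≤ η₁ * ∫ x, a s x := fun s hs =>
    (hguard s hs).trans (mul_le_mul_of_nonneg_right (min_le_left _ _) (hint_nn s))
  have hguardT : ∀ s ∈ Icc 0 t₁, σ ^ 3 * (⨆ x, a s x) ≤ ηT * ∫ x, a s x := fun s hs =>
    (hguard s hs).trans (mul_le_mul_of_nonneg_right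
      ((min_le_right _ _).trans (min_le_left _ _)) (hint_nn s))
  have hσ2 : σ ≤ 1 / 2 := by
    have h8 : σ ^ 3 * (⨆ x, a 0 x) ≤ 1 / 8 * (⨆ x, a 0 x) :=
      (hguard 0 h0).trans ((mul_le_mul_of_nonneg_right
        ((min_le_right _ _).trans (min_le_right _ _)) (hint_nn 0)).trans
        (mul_le_mul_of_nonneg_left (hint_le 0) (by norm_num)))
    have hsup_pos : 0 < ⨆ x, a 0 x :=
      lt_of_lt_of_le (ha0 0 0) (le_ciSup (isCompact_range (ha.uncurry_left 0)).bddAbove 0)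
    have h8' : σ ^ 3 ≤ (1 / 2) ^ 3 := by nlinarith
    exact le_of_pow_le_pow_left₀ (by norm_num) (by norm_num) h8'
  -- Step 2: the numeric bounds of the family (S6 at the ZERO weights — weight-independent),
  -- `β₁` (the rung at `(Θ, U, C, Λ, σ)`), `γ₀` (the tails); the threshold is fixed HERE
  obtain ⟨Θ, U, Λ, hΘ1, hU0, hΛ1, hΘb, hUb, hΛb, -⟩ :=
    stub_familyModulus t₁ a θ₀ u₀ ha hθ hu ha0 hθ0 (fun _ _ => 0) (fun _ _ => 0) (fun _ _ => 0)
      continuous_const continuous_const continuous_const (fun _ _ => 0) (fun s y => by simp)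
  obtain ⟨β₁, hβ₁, hK1⟩ := hK' Θ U C Λ hΘ1 hU0 hC0 hΛ1 σ hσ
  obtain ⟨γ₀, hγ₀, hT1⟩ := hT' t₁ a θ₀ u₀ ha hθ hu ha0 hθ0 σ hσ hguardT Φ
  refine ⟨min (β₁ / 4) (γ₀ / (24 * (C + 1))), lt_min (by positivity) (by positivity), ?_⟩
  -- only now the weights
  intro A b G hA hb hG F hF hCb h1 hv hE β hβ ε hε
  have hFc : ∀ s, Continuous (F s) := fun s =>
    (tbn_continuous_kcw (hA.uncurry_left s) (hb.uncurry_left s) (hG.uncurry_left s)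
      (hu.uncurry_left s)).congr fun y => (hF s y).symm
  -- the joint modulus of THIS class functional (S6 again, its bounds discarded)
  obtain ⟨-, -, -, -, -, -, -, -, -, hmod⟩ :=
    stub_familyModulus t₁ a θ₀ u₀ ha hθ hu ha0 hθ0 A b G hA hb hG F hF
  have hβ1 : |β| ≤ β₁ / 4 := hβ.trans (min_le_left _ _)
  have hβ2 : |β| ≤ γ₀ / (24 * (C + 1)) := hβ.trans (min_le_right _ _)
  have h4 : |4 * β| = 4 * |β| := by rw [abs_mul, abs_of_pos (by norm_num : (0 : ℝ) < 4)]
  have h4β : |4 * β| ≤ β₁ := by rw [h4]; linarith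
  -- Step 3: the window tails at rate `γ = 24|β|C`, precision `ε/4`; this also fixes the tails'
  -- window threshold `τT`
  obtain ⟨γ, hγ0, hγle, hγ4⟩ : ∃ γ : ℝ, 0 ≤ γ ∧ γ ≤ γ₀ ∧ |4 * β| * (6 * C) ≤ γ := by
    refine ⟨24 * |β| * C, by positivity, ?_, by rw [h4]; linarith⟩
    rw [le_div_iff₀ (by positivity)] at hβ2
    nlinarith [abs_nonneg β]
  obtain ⟨V, hV1, τT, hτT, hT2⟩ := hT1 γ hγ0 hγle (ε / 4) (by positivity)
  -- Step 4: the joint modulus at radius `√(2V)` and the change of reference law, precision `ε/4`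
  obtain ⟨ω, hω, hβω⟩ : ∃ ω : ℝ, 0 < ω ∧ |β| * ω ≤ ε / 4 := by
    refine ⟨ε / 4 / (|β| + 1), by positivity, ?_⟩
    rw [show |β| * (ε / 4 / (|β| + 1)) = ε / 4 * (|β| / (|β| + 1)) by ring]
    exact mul_le_of_le_one_right (by positivity) ((div_le_one (by positivity)).2 (by linarith))
  obtain ⟨δ₁, hδ₁, hmod1⟩ := hmod (Real.sqrt (2 * V)) ω hω
  obtain ⟨δ₂, hδ₂, hlaw⟩ :=
    stub_lawChangeFamily t₁ a θ₀ u₀ ha hθ hu ha0 hθ0 σ hσ hσ2 (ε / 4) (by positivity)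
  obtain ⟨δ, hδ, hδ1, hδ2⟩ : ∃ δ : ℝ, 0 < δ ∧ δ ≤ δ₁ ∧ δ ≤ δ₂ :=
    ⟨min δ₁ δ₂, lt_min hδ₁ hδ₂, min_le_left _ _, min_le_right _ _⟩
  -- Step 5: the net `s_k = min t₁ (kδ)` and the pointwise rung at every node, tilt `4β`;
  -- the window threshold is the net's plus the tails'
  obtain ⟨sk, hsk, hsk_eq⟩ : ∃ sk : ℕ → ℝ, (∀ k, sk k ∈ Icc 0 t₁) ∧
      ∀ k : ℕ, (k : ℝ) * δ ≤ t₁ → sk k = k * δ :=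
    ⟨fun k => min t₁ (k * δ), fun k => ⟨le_min ht (by positivity), min_le_left _ _⟩,
      fun k hk => min_eq_right hk⟩
  have hnet := fun k : ℕ =>
    hK1 (a (sk k)) (θ₀ (sk k)) (u₀ (sk k)) (ha.uncurry_left _) (hθ.uncurry_left _)
      (hu.uncurry_left _) (hΛb _ (hsk k)) (hΘb _ (hsk k)) (hUb _ (hsk k)) (hguard1 _ (hsk k)) Φ
      (A (sk k)) (b (sk k)) (G (sk k)) (hA.uncurry_left _) (hb.uncurry_left _)
      (hG.uncurry_left _) (F (sk k)) (hF (sk k)) (hCb _ (hsk k)) (h1 _ (hsk k))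
      (hv _ (hsk k)) (hE _ (hsk k)) (4 * β) h4β ε hε
  obtain ⟨τ₀, hτ₀, hnet'⟩ := tbn_net_thresholds (Finset.range (⌈t₁ / δ⌉₊ + 1)) hnet
  refine ⟨τ₀ + τT, by positivity, fun τ hτ => ?_⟩
  have hτpos : 0 < τ := by linarith
  obtain ⟨N₁, hN₁⟩ := hnet' τ (by linarith [hτT.le])
  obtain ⟨NT, hNT⟩ := hT2 τ (by linarith [hτ₀.le])
  refine ⟨N₁ + NT, fun N hN s' hs' => ?_⟩
  -- Step 6: the nearest node to the left of `s'`
  obtain ⟨k, hkδ, hs'k, hk_mem⟩ : ∃ k : ℕ, (k : ℝ) * δ ≤ s' ∧ s' < k * δ + δ ∧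
      k ∈ Finset.range (⌈t₁ / δ⌉₊ + 1) := by
    refine ⟨⌊s' / δ⌋₊, ?_, ?_, ?_⟩
    · have h := Nat.floor_le (div_nonneg hs'.1 hδ.le)
      rwa [le_div_iff₀ hδ] at h
    · have h := Nat.lt_floor_add_one (s' / δ)
      rw [div_lt_iff₀ hδ] at h
      linarith
    · exact Finset.mem_range.2 (Nat.lt_add_one_iff.2 ((Nat.floor_le_ceil _).trans
        (Nat.ceil_le_ceil (div_le_div_of_nonneg_right hs'.2 hδ.le))))
  have hdist : |sk k - s'| ≤ δ := by
    rw [hsk_eq k (hkδ.trans hs'.2), abs_sub_comm, abs_of_nonneg (by linarith)]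
    linarith
  have hw : 0 < τ * ((N : ℝ) + 1) ^ (-(1 / 3 : ℝ)) :=
    mul_pos hτpos (Real.rpow_pos_of_pos (by positivity) _)
  have hPgood : (localGibbsLaw σ (a (sk k)) (u₀ (sk k)) (θ₀ (sk k)) N (Φ N)) (Φ N).goodᶜ = 0 :=
    localGibbsLaw_absolutelyContinuous σ _ _ _ N (Φ N) (Φ N).measure_compl_good
  -- pointwise `|F_{s'} − F_{s_k}| ≤ ω + 6C·max 0 (‖v‖² − V)`; the window functional is measurable
  have hdiff : ∀ y, |F s' y - F (sk k) y| ≤ ω + 6 * C * max 0 (‖y.2‖ ^ 2 - V) :=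
    tbn_abs_sub_le_of_modulus hC0 hV1 hω.le (hCb _ (hsk k)) (hCb s' hs') fun x v hxv =>
      hmod1 s' hs' (sk k) (hsk k) (by rw [abs_sub_comm]; exact hdist.trans hδ1) x v hxv
  have hmeas : AEMeasurable (fun z => ENNReal.ofReal (Real.exp (β * ∑ i,
      (τ * ((N : ℝ) + 1) ^ (-(1 / 3 : ℝ)))⁻¹ * ∫ r in (0 : ℝ)..(τ * ((N : ℝ) + 1) ^ (-(1 / 3 : ℝ))),
      F s' ((Φ N).flow r z i)))) (liouville (Torus.geometry (Fin 3)) (N + 1) (hsDiameter σ N)) := by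
    refine (Real.measurable_exp.comp_aemeasurable (AEMeasurable.const_mul
      (Finset.aemeasurable_fun_sum _ fun i _ => ?_) β)).ennreal_ofReal
    exact ((Φ N).aemeasurable_intervalIntegral_comp_flow_torus
      ((hFc s').measurable.comp (measurable_pi_apply i)) 0 _ (Φ N).measure_compl_good).const_mul _
  -- (a) change of reference law `λ_{s'} → λ_{s_k}` (S5); (b) split of the square; (c) the rung at
  -- the node, tilt `4β`; (d) the difference via the tails; (e) `ε/4 + ε/4 + (4|β|ω + ε/4)/4 ≤ ε`
  have haa := hlaw Φ N (sk k) (hsk k) s' hs' (hdist.trans hδ2) _ hmeas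
  have hbb := tbn_lintegral_sq_le_split (Φ N) hPgood (hFc (sk k)) (hFc s')
    (τ * ((N : ℝ) + 1) ^ (-(1 / 3 : ℝ))) β
  have hdd := (tbn_lintegral_exp_window_sub_le (Φ N) hPgood (hFc (sk k)) (hFc s') hdiff hw
    (4 * β) (c := 4 * |β| * ω * ((N : ℝ) + 1)) (γ := γ) (by rw [Nat.cast_add_one, h4]) hγ4).trans
    (mul_le_mul' le_rfl (hNT N ((Nat.le_add_left NT N₁).trans hN) (sk k) (hsk k)))
  exact tbn_chain_le haa hbb (hN₁ N ((Nat.le_add_right N₁ NT).trans hN) k hk_mem) hdd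
    (by positivity) (by linarith)

/-! ## §3 Scaling `F ↦ F/C`: the class is a cone -/

/-- **`KCWUSharpPlus → KineticLDExplicitFamily` by scaling.** Take the threshold `β₁` of
`transferByNets_explicit` at `C = 1` (fixed before the weights); for weights `(A, b, G)` with growth
constant `C > 0` and `|β| ≤ β₁/C`, the scaled functional `F/C` is the class functional of the weights
`(A/C, b/C, G)`, has growth `1·(1+‖v‖²)`, inherits the three orthogonality relations by linearity of the
integral, and `β Σᵢ w⁻¹∫₀ʷ F = (βC) Σᵢ w⁻¹∫₀ʷ (F/C)` with `|βC| ≤ β₁`. [folklore] -/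
theorem kineticLDExplicitFamily_of_kcwuSharpPlus (hK : KCWUSharpPlus) :
    KineticLDExplicitFamily := by
  obtain ⟨η₀, hη₀, H⟩ := transferByNets_explicit hK
  refine ⟨η₀, hη₀, fun t₁ a θ₀ u₀ ha hθ hu ha0 hθ0 σ hσ hg Φ => ?_⟩
  obtain ⟨β₁, hβ₁, H1⟩ := H t₁ a θ₀ u₀ ha hθ hu ha0 hθ0 σ hσ hg Φ 1 zero_le_one
  refine ⟨β₁, hβ₁, ?_⟩
  intro A b G hA hb hG C hC F hCb h1 hv hE β hβ ε hε
  have hCinv : 0 < C⁻¹ := inv_pos.2 hC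
  -- the scaled functional and weights
  let F' : ℝ → T3 × V3 → ℝ := fun s y => C⁻¹ * F s y
  have hF'ap : ∀ s y, F' s y = C⁻¹ * F s y := fun _ _ => rfl
  have hA' : Continuous (Function.uncurry fun s x j k => C⁻¹ * A s x j k) :=
    continuous_pi fun j => continuous_pi fun k =>
      continuous_const.mul ((continuous_apply k).comp ((continuous_apply j).comp hA))
  have hb' : Continuous (Function.uncurry fun s x => C⁻¹ • b s x) := hb.const_smul C⁻¹
  have hF' : ∀ s y, F' s y =
      (∑ j : Fin 3, ∑ k : Fin 3, (C⁻¹ * A s y.1 j k) * ((y.2 - u₀ s y.1) j * (y.2 - u₀ s y.1) k)) +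
        (∑ j : Fin 3, (C⁻¹ • b s y.1) j * (y.2 - u₀ s y.1) j) *
          G s (y.1, ‖y.2 - u₀ s y.1‖ ^ 2) := by
    intro s y
    simp only [hF'ap, F, PiLp.smul_apply, smul_eq_mul, mul_add, Finset.mul_sum, Finset.sum_mul,
      mul_assoc]
  have hCb' : ∀ s ∈ Icc 0 t₁, ∀ y : T3 × V3, |F' s y| ≤ 1 * (1 + ‖y.2‖ ^ 2) := by
    intro s hs y
    rw [hF'ap, abs_mul, abs_of_pos hCinv, one_mul]
    calc C⁻¹ * |F s y| ≤ C⁻¹ * (C * (1 + ‖y.2‖ ^ 2)) :=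
          mul_le_mul_of_nonneg_left (hCb s hs y) hCinv.le
      _ = 1 + ‖y.2‖ ^ 2 := by rw [inv_mul_cancel_left₀ hC.ne']
  have h1' : ∀ s ∈ Icc 0 t₁, ∀ x,
      ∫ v, F' s (x, v) * localMaxwellian 1 (θ₀ s x) (u₀ s x) v = 0 := by
    intro s hs x
    have h := h1 s hs x
    simp only [hF'ap, mul_assoc] at h ⊢
    rw [integral_const_mul, h, mul_zero]
  have hv' : ∀ s ∈ Icc 0 t₁, ∀ x (j : Fin 3),
      ∫ v, F' s (x, v) * v j * localMaxwellian 1 (θ₀ s x) (u₀ s x) v = 0 := by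
    intro s hs x j
    have h := hv s hs x j
    simp only [hF'ap, mul_assoc] at h ⊢
    rw [integral_const_mul, h, mul_zero]
  have hE' : ∀ s ∈ Icc 0 t₁, ∀ x,
      ∫ v, F' s (x, v) * ‖v‖ ^ 2 * localMaxwellian 1 (θ₀ s x) (u₀ s x) v = 0 := by
    intro s hs x
    have h := hE s hs x
    simp only [hF'ap, mul_assoc] at h ⊢
    rw [integral_const_mul, h, mul_zero]
  have hβC : |β * C| ≤ β₁ := by
    rw [abs_mul, abs_of_pos hC]
    rwa [le_div_iff₀ hC] at hβ
  obtain ⟨τ₀, hτ₀, H2⟩ := H1 (fun s x j k => C⁻¹ * A s x j k) (fun s x => C⁻¹ • b s x) G hA' hb' hG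
    F' hF' hCb' h1' hv' hE' (β * C) hβC ε hε
  refine ⟨τ₀, hτ₀, fun τ hτ => ?_⟩
  obtain ⟨N₀, hN₀⟩ := H2 τ hτ
  refine ⟨N₀, fun N hN s hs => le_of_eq_of_le (lintegral_congr fun z => ?_) (hN₀ N hN s hs)⟩
  -- `β Σᵢ w⁻¹∫ F = (βC) Σᵢ w⁻¹∫ (F/C)`
  congr 2
  simp only [hF'ap, intervalIntegral.integral_const_mul]
  rw [Finset.mul_sum, Finset.mul_sum]
  refine Finset.sum_congr rfl fun i _ => ?_
  rw [show β * C * ((τ * ((N : ℝ) + 1) ^ (-(1 / 3 : ℝ)))⁻¹ *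
      (C⁻¹ * ∫ r in (0 : ℝ)..(τ * ((N : ℝ) + 1) ^ (-(1 / 3 : ℝ))), F s ((Φ N).flow r z i))) =
      β * (C * C⁻¹) * ((τ * ((N : ℝ) + 1) ^ (-(1 / 3 : ℝ)))⁻¹ *
      ∫ r in (0 : ℝ)..(τ * ((N : ℝ) + 1) ^ (-(1 / 3 : ℝ))), F s ((Φ N).flow r z i)) by ring,
    mul_inv_cancel₀ hC.ne', mul_one]

/-! ## §4 The stub -/

/-- **Stub S_E of line `tail-rate` (crux stmt-AtomisticToContinuum-16625), by name and signature**: the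
numeric pointwise rung `KCWUSharpPlus` implies the explicit family node `KineticLDExplicitFamily`
(`kineticLDExplicitFamily_of_kcwuSharpPlus`). [folklore] -/
theorem stub_explicitKineticFamily : ExplicitKineticFamilyUpgrade :=
  kineticLDExplicitFamily_of_kcwuSharpPlus

end Summit.AtomisticToContinuum.HydrodynamicLimit.Theorems.TransferEntropyClockExplicitKineticFamily

end
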